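import Literature.NumberTheory.Automorphic.AdelicSchwartzBruhatDirectSumSpan
import Literature.NumberTheory.Weil1964.AdelicMetaplecticSeesawSum
import HarnessLib

/-!
# A functional on `𝒮(𝔸^{ι₁ ⊕ ι₂})`, continuous in the archimedean slot and non-zero, is non-zero on a PURE TENSOR `Φ₁ ⊠ Φ₂` — given the density of
# archimedean separate-variable products (organ (O45ii) of socket #44∕45R made an explicit hypothesis)

Track B ∕ hLiu418 = stmt-HodgeConjecture-24832, line `K2_Liu_CurveThetaSigs`, unit U6 ED. 6, socket #44∕45R `sig_K2LiuUndoublingSeparation`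
(«SEPARATION OF VARIABLES BY PURE TENSORS»); seat `hodgecm-mathlib-K2Liu-p03` (g3).  The doubling pairing of the hypothesis kernel of #44∕45R is
a LINEAR functional `ℓ` of the Schwartz–Bruhat function `Φ′ ∈ 𝒮(𝔸^{n″})`, CONTINUOUS on every archimedean slot `φ ↦ φ ⊗ Φ_f` (★ p855914
`continuous_doublingPairing_doubledLineThetaIntegral_tmul`, organ (O45)(i)), and non-zero.  The finite factor of `𝒮(𝔸^{ι₁ ⊕ ι₂})` is an
algebraic tensor product (★ `AdelicSchwartzBruhatDirectSumSpan`: «the ONLY obstruction to being a finite sum of pure tensors is archimedean»),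
so the one analytic input is the DENSITY of the span of the separate-variable products `Φ₁^∞ ⊠_∞ Φ₂^∞` (★ `archBoxTensor`) in the Schwartz space
`𝓢((ι₁ ⊕ ι₂ → L⁺ ⊗ ℝ), ℂ)` — [Treves1967, Thm. 51.6: `𝒮(ℝ^m) ⊗̂ 𝒮(ℝ^n) ≅ 𝒮(ℝ^{m+n})`], equivalently the density of the Hermite functions; NOT
in the tree ∕ Mathlib, so it is carried here as the explicit hypothesis `hD` (organ (O45ii) of the socket; a re-typing of #42R ∕ #44∕45R with
`Φ′` in the algebraic span of pure tensors would make it disappear — see the bus, K2Liu-p03 (g3) 00:46Z).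

* `eq_zero_of_forall_tensorToSum_eq_zero` — `ℓ` linear, archimedean-slot continuous, `ℓ(Φ₁ ⊠ Φ₂) = 0` for all pure tensors, `hD` ⇒ `ℓ = 0`;
* `exists_tensorToSum_ne_zero` — `ℓ Φ ≠ 0` ⇒ `∃ Φ₁ Φ₂, ℓ(Φ₁ ⊠ Φ₂) ≠ 0`;
* `exists_sumTensor_ne_zero` — the same along any index split `e : κ ≃ ι₁ ⊕ ι₂` (★ `sumTensor`, the tensors of ★ `K2LiuDoubledKernelUndoubling`),
  with the continuity hypothesis on the `κ`-side archimedean slot (★ `piSBReindex_tmul`: re-enumeration is `R_e^∞ ⊗ R_e^f` on pure tensors).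

No definition, no instance, no named fact, no `sorry`; axioms ⊆ {propext, Classical.choice, Quot.sound}.

## References
* [Treves1967] F. Trèves, *Topological Vector Spaces, Distributions and Kernels* (1967), Thm. 51.6 (and Cor.), p. 530.
* [Weil1964] A. Weil, Acta Math. 111 (1964), Chap. I n° 29 (standard functions are finite sums of products of local ones).
* [HarrisKudlaSweet1996] M. Harris, S. Kudla, W. J. Sweet, J. AMS 9 (1996), §1 proof of Lem. 1.1.

HONEST LABEL: HC_CM is proved only modulo the 7 printed citations (2 remaining named inputs: hLiu418 = stmt-HodgeConjecture-24832, h413 =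
stmt-HodgeConjecture-24833) until rung 0 closes; this helper moves no counter.
-/

set_option autoImplicit false

set_option linter.dupNamespace false

noncomputable section

open NumberField NumberField.mixedEmbedding IsDedekindDomain
open scoped SchwartzMap TensorProduct Classical

namespace Summit.HodgeConjecture.HodgeConjecture.Cruxes.HLiu418.K2LiuPureTensorWitness

open Literature.NumberTheory.Automorphic Literature.NumberTheory.Weil1964

variable {K : Type} [Field K] [NumberField K] {ι₁ ι₂ : Type} [Fintype ι₁] [Fintype ι₂]

/-- **A linear functional on `𝒮(𝔸^{ι₁ ⊕ ι₂})` that is continuous on every archimedean slot and kills all pure tensors is zero — given the density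
of the separate-variable products in the archimedean Schwartz space.**  For fixed `Φ_f`, `φ ↦ ℓ(φ ⊗ Φ_f)` is continuous, linear, and vanishes on
`Φ₁^∞ ⊠_∞ Φ₂^∞` (such `(Φ₁^∞ ⊠_∞ Φ₂^∞) ⊗ Φ_f` are finite sums of pure tensors, ★ `piSchwartzBruhatEquiv_archBoxTensor_tmul_mem_span_tensorToSum`),
hence on their dense span, hence everywhere; and every `Φ` is a finite sum of `φ ⊗ Φ_f` (★ `piSchwartzBruhatEquiv`).
[cite: Treves1967, Thm. 51.6 p. 530] [cite: Weil1964, Chap. I n° 29] -/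
theorem eq_zero_of_forall_tensorToSum_eq_zero [DecidableEq ι₁] [DecidableEq ι₂]
    (hD : Dense ((Submodule.span ℂ (Set.range fun p : 𝓢((ι₁ → mixedSpace K), ℂ) × 𝓢((ι₂ → mixedSpace K), ℂ) =>
      archBoxTensor p.1 p.2) : Submodule ℂ 𝓢((ι₁ ⊕ ι₂ → mixedSpace K), ℂ)) : Set 𝓢((ι₁ ⊕ ι₂ → mixedSpace K), ℂ)))
    (ℓ : piSchwartzBruhat K (ι₁ ⊕ ι₂) →ₗ[ℂ] ℂ)
    (hcont : ∀ f : FinSB K (ι₁ ⊕ ι₂), Continuous fun a : 𝓢((ι₁ ⊕ ι₂ → mixedSpace K), ℂ) => ℓ (piSchwartzBruhatEquiv K (ι₁ ⊕ ι₂) (a ⊗ₜ[ℂ] f)))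
    (hzero : ∀ (Φ₁ : piSchwartzBruhat K ι₁) (Φ₂ : piSchwartzBruhat K ι₂), ℓ (tensorToSum K ι₁ ι₂ Φ₁ Φ₂) = 0) :
    ℓ = 0 := by
  -- `ℓ` vanishes on the span of the pure tensors
  have hspan : ∀ Φ ∈ Submodule.span ℂ
      (Set.range fun p : ↥(piSchwartzBruhat K ι₁) × ↥(piSchwartzBruhat K ι₂) => tensorToSum K ι₁ ι₂ p.1 p.2), ℓ Φ = 0 := by
    intro Φ hΦ
    have hle : Submodule.span ℂ
        (Set.range fun p : ↥(piSchwartzBruhat K ι₁) × ↥(piSchwartzBruhat K ι₂) => tensorToSum K ι₁ ι₂ p.1 p.2) ≤ LinearMap.ker ℓ := by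
      refine Submodule.span_le.2 ?_
      rintro _ ⟨p, rfl⟩
      exact (LinearMap.mem_ker).2 (hzero p.1 p.2)
    exact (LinearMap.mem_ker).1 (hle hΦ)
  -- for fixed `Φ_f`, the archimedean slot functional vanishes identically (density + continuity)
  have hslot : ∀ (f : FinSB K (ι₁ ⊕ ι₂)) (a : 𝓢((ι₁ ⊕ ι₂ → mixedSpace K), ℂ)), ℓ (piSchwartzBruhatEquiv K (ι₁ ⊕ ι₂) (a ⊗ₜ[ℂ] f)) = 0 := by
    intro f a
    -- the slot functional as a linear map
    let g : 𝓢((ι₁ ⊕ ι₂ → mixedSpace K), ℂ) →ₗ[ℂ] ℂ :=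
      ℓ ∘ₗ (piSchwartzBruhatEquiv K (ι₁ ⊕ ι₂)).toLinearMap ∘ₗ ((TensorProduct.mk ℂ _ (FinSB K (ι₁ ⊕ ι₂))).flip f)
    have hg : ∀ b, g b = ℓ (piSchwartzBruhatEquiv K (ι₁ ⊕ ι₂) (b ⊗ₜ[ℂ] f)) := fun _ => rfl
    -- `g` kills the span of the separate-variable products
    have hker : (Submodule.span ℂ (Set.range fun p : 𝓢((ι₁ → mixedSpace K), ℂ) × 𝓢((ι₂ → mixedSpace K), ℂ) =>
        archBoxTensor p.1 p.2) : Submodule ℂ 𝓢((ι₁ ⊕ ι₂ → mixedSpace K), ℂ)) ≤ LinearMap.ker g := by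
      refine Submodule.span_le.2 ?_
      rintro _ ⟨p, rfl⟩
      exact (LinearMap.mem_ker).2 ((hg _).trans (hspan _ (piSchwartzBruhatEquiv_archBoxTensor_tmul_mem_span_tensorToSum p.1 p.2 f)))
    -- the zero set of `g` is closed and contains a dense set
    have hclosed : IsClosed {b : 𝓢((ι₁ ⊕ ι₂ → mixedSpace K), ℂ) | g b = 0} := by
      simp only [hg]
      exact isClosed_eq (hcont f) continuous_const
    have hsub : ((Submodule.span ℂ (Set.range fun p : 𝓢((ι₁ → mixedSpace K), ℂ) × 𝓢((ι₂ → mixedSpace K), ℂ) =>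
        archBoxTensor p.1 p.2) : Submodule ℂ 𝓢((ι₁ ⊕ ι₂ → mixedSpace K), ℂ)) : Set 𝓢((ι₁ ⊕ ι₂ → mixedSpace K), ℂ)) ⊆
        {b | g b = 0} := fun b hb => (LinearMap.mem_ker).1 (hker hb)
    have hall : a ∈ {b : 𝓢((ι₁ ⊕ ι₂ → mixedSpace K), ℂ) | g b = 0} :=
      (hD.closure_eq ▸ (closure_minimal hsub hclosed)) (Set.mem_univ a)
    exact (hg a).symm.trans hall
  -- every `Φ` is a finite sum of `φ ⊗ Φ_f`
  refine LinearMap.ext fun Φ => ?_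
  obtain ⟨t, rfl⟩ : ∃ t, piSchwartzBruhatEquiv K (ι₁ ⊕ ι₂) t = Φ :=
    ⟨(piSchwartzBruhatEquiv K (ι₁ ⊕ ι₂)).symm Φ, LinearEquiv.apply_symm_apply _ _⟩
  induction t using TensorProduct.induction_on with
  | zero => rw [map_zero, map_zero, LinearMap.zero_apply]
  | tmul a f => rw [hslot f a, LinearMap.zero_apply]
  | add t₁ t₂ h₁ h₂ => simp only [map_add, h₁, h₂, LinearMap.zero_apply, add_zero]

/-- **A non-zero such functional is non-zero on a pure tensor `Φ₁ ⊠ Φ₂`.** [cite: Treves1967, Thm. 51.6 p. 530] [cite: HarrisKudlaSweet1996, §1 proof of Lem. 1.1] -/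
theorem exists_tensorToSum_ne_zero [DecidableEq ι₁] [DecidableEq ι₂]
    (hD : Dense ((Submodule.span ℂ (Set.range fun p : 𝓢((ι₁ → mixedSpace K), ℂ) × 𝓢((ι₂ → mixedSpace K), ℂ) =>
      archBoxTensor p.1 p.2) : Submodule ℂ 𝓢((ι₁ ⊕ ι₂ → mixedSpace K), ℂ)) : Set 𝓢((ι₁ ⊕ ι₂ → mixedSpace K), ℂ)))
    (ℓ : piSchwartzBruhat K (ι₁ ⊕ ι₂) →ₗ[ℂ] ℂ)
    (hcont : ∀ f : FinSB K (ι₁ ⊕ ι₂), Continuous fun a : 𝓢((ι₁ ⊕ ι₂ → mixedSpace K), ℂ) => ℓ (piSchwartzBruhatEquiv K (ι₁ ⊕ ι₂) (a ⊗ₜ[ℂ] f)))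
    {Φ : piSchwartzBruhat K (ι₁ ⊕ ι₂)} (hΦ : ℓ Φ ≠ 0) :
    ∃ (Φ₁ : piSchwartzBruhat K ι₁) (Φ₂ : piSchwartzBruhat K ι₂), ℓ (tensorToSum K ι₁ ι₂ Φ₁ Φ₂) ≠ 0 := by
  by_contra h
  have h' : ∀ (Φ₁ : piSchwartzBruhat K ι₁) (Φ₂ : piSchwartzBruhat K ι₂), ℓ (tensorToSum K ι₁ ι₂ Φ₁ Φ₂) = 0 :=
    fun Φ₁ Φ₂ => by
      by_contra hne
      exact h ⟨Φ₁, Φ₂, hne⟩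
  exact hΦ (by rw [eq_zero_of_forall_tensorToSum_eq_zero hD ℓ hcont h', LinearMap.zero_apply])

/-- **The same along an index split `e : κ ≃ ι₁ ⊕ ι₂`** (the tensors ★ `sumTensor K e Φ₁ Φ₂ = R_e⁻¹(Φ₁ ⊠ Φ₂)` of the undoubling organs), with the
continuity hypothesis on the `κ`-side archimedean slot (re-enumeration is `R_e^∞ ⊗ R_e^f` on pure tensors, ★ `piSBReindex_tmul`; `R_e^∞` is a
continuous linear map of Schwartz spaces, ★ `schwartzReindexCLM`). [cite: Treves1967, Thm. 51.6 p. 530] [cite: HarrisKudlaSweet1996, §1 proof of Lem. 1.1] -/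
theorem exists_sumTensor_ne_zero {κ : Type} [Fintype κ] [DecidableEq κ] [DecidableEq ι₁] [DecidableEq ι₂] (e : κ ≃ ι₁ ⊕ ι₂)
    (hD : Dense ((Submodule.span ℂ (Set.range fun p : 𝓢((ι₁ → mixedSpace K), ℂ) × 𝓢((ι₂ → mixedSpace K), ℂ) =>
      archBoxTensor p.1 p.2) : Submodule ℂ 𝓢((ι₁ ⊕ ι₂ → mixedSpace K), ℂ)) : Set 𝓢((ι₁ ⊕ ι₂ → mixedSpace K), ℂ)))
    (ℓ : piSchwartzBruhat K κ →ₗ[ℂ] ℂ)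
    (hcont : ∀ f : FinSB K κ, Continuous fun a : 𝓢((κ → mixedSpace K), ℂ) => ℓ (piSchwartzBruhatEquiv K κ (a ⊗ₜ[ℂ] f)))
    {Φ : piSchwartzBruhat K κ} (hΦ : ℓ Φ ≠ 0) :
    ∃ (Φ₁ : piSchwartzBruhat K ι₁) (Φ₂ : piSchwartzBruhat K ι₂), ℓ (sumTensor K e Φ₁ Φ₂) ≠ 0 := by
  -- transport `ℓ` to `ι₁ ⊕ ι₂`
  let ℓ' : piSchwartzBruhat K (ι₁ ⊕ ι₂) →ₗ[ℂ] ℂ := ℓ ∘ₗ (piSBReindex K e).symm.toLinearMap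
  have hℓ' : ∀ Ψ, ℓ' Ψ = ℓ ((piSBReindex K e).symm Ψ) := fun _ => rfl
  have hcont' : ∀ f : FinSB K (ι₁ ⊕ ι₂),
      Continuous fun a : 𝓢((ι₁ ⊕ ι₂ → mixedSpace K), ℂ) => ℓ' (piSchwartzBruhatEquiv K (ι₁ ⊕ ι₂) (a ⊗ₜ[ℂ] f)) := by
    intro f
    have heq : (fun a : 𝓢((ι₁ ⊕ ι₂ → mixedSpace K), ℂ) => ℓ' (piSchwartzBruhatEquiv K (ι₁ ⊕ ι₂) (a ⊗ₜ[ℂ] f))) =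
        (fun b : 𝓢((κ → mixedSpace K), ℂ) => ℓ (piSchwartzBruhatEquiv K κ (b ⊗ₜ[ℂ] finSBReindex K e.symm f))) ∘
          schwartzReindexCLM K e.symm := by
      funext a
      simp only [Function.comp_apply, hℓ', piSBReindex_symm, piSBReindex_tmul]
    rw [heq]
    exact (hcont _).comp (schwartzReindexCLM K e.symm).continuous
  have hΦ' : ℓ' (piSBReindex K e Φ) ≠ 0 := by
    rwa [hℓ', LinearEquiv.symm_apply_apply]
  obtain ⟨Φ₁, Φ₂, h⟩ := exists_tensorToSum_ne_zero hD ℓ' hcont' hΦ'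
  exact ⟨Φ₁, Φ₂, by rwa [hℓ', ← sumTensor_def] at h⟩

end Summit.HodgeConjecture.HodgeConjecture.Cruxes.HLiu418.K2LiuPureTensorWitness

end
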